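import Summits.HodgeConjecture.HodgeConjecture.Theorems.Ring2AbelianAllAndreProductPencils
import Summits.HodgeConjecture.HodgeConjecture.Theorems.Ring2AbelianAllLefschetzPencilsRungs
import Summits.HodgeConjecture.HodgeConjecture.Theorems.Ring2AbelianAllSpreadFloorHeredity
import Summits.HodgeConjecture.HodgeConjecture.Theorems.Ring2HypothesesDescentStandardBSurjective
import Summits.HodgeConjecture.HodgeConjecture.Theorems.Ring2HypothesesDescentAlgebraicQuasiInverseRows
import Summits.HodgeConjecture.HodgeConjecture.Theorems.Ring2AbelianAllAndreLiebermanDischargedRows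
import Literature.AlgebraicGeometry.Motives.AbelianVarietyExistence
import HarnessLib

/-!
# Ring 2 hypotheses, descent face — THE RUNGS OF X ARE NESTED: `(5∀)_{d+r} ⟹ (5∀)_d` and `(5)_{d+r} ⟹ (5)_d` for all
# `d, r`, hence X = `LefschetzBCompactPencils` IS EQUIVALENT TO EACH OF ITS TAILS `∀ d ≥ d₀, (5∀)_d` — unconditionally

research route conditional on HC_CM; not a corollary; Q11.4-sentence-2 already refuted in dim ≥ 3.
Cell `pub-hodge-ring2` (Hodge ladder STAGE 3), seat `ring2-b05` (binder row b05
`Ring2.Hypotheses.MotivatedImpliesAlgebraicAV`, published modulo X = `Ring2.AbelianAll.LefschetzBCompactPencils`), gen 43,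
fourth file. `HC_CM` (`Theses.RankFourFaces.CMAbelianHodge`) occurs ONLY as the displayed binder `hCM` of the last row
(the cell row re-keyed), never restated; nothing here proves a case of the Hodge conjecture; no binder is discharged;
X, its rungs `(5∀)_d` / `(5)_d` and row b05 stay OPEN and are displayed as hypotheses only.

THE OBSERVATION. The sub-cell AbelianAll grades X = (5∀) by the relative dimension `d` of the pencil
(`LefschetzBCompactPencilsAtRelDim d`, `lefschetzBCompactPencils_iff_forall_atRelDim`), knows the rungs `d ≤ 1`
unconditionally and `d = 2` modulo Tankeev 2011, and books «first open rung d = 3 mod h_T». The rungs are in fact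
NESTED DOWNWARD, fact-free: given a compact pencil `f : 𝒳 ⟶ S` of abelian `d`-folds and ANY abelian `r`-fold `B`, the
product family `B × 𝒳 ⟶ S` is a compact pencil of abelian `(r+d)`-folds (ab-andre-2 XXXII-a,
`isCompactAbelianPencil_snd_comp`), with the same CM points when `B` is of CM type (`cmLocus_subset_cmLocus_snd_comp`),
and its total space `B × 𝒳` surjects onto `𝒳` (the projection has the section `(0_B, 𝟙)`); `B⋆` descends along
surjections of smooth projective varieties (gen 41, `standardConjectureBStar_of_surjective_of_forall`, Arapura Cor. 1.2 /
Lemma 4.2 on the carriers). Abelian varieties (resp. CM abelian varieties) of every dimension exist in the tree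
(`exists_abelianVariety_dim_eq_succ`, resp. `exists_isOfCMType_dim_eq_succ`). Hence:

* §1 `lefschetzB_pencil_of_prod` — `B⋆` for `𝒳` from `B⋆` for `B × 𝒳` (one pencil, one abelian variety `B`).
* §2 **`lefschetzBCompactPencilsAtRelDim_of_add` — `(5∀)_{r+d} ⟹ (5∀)_d`**; `lefschetzBCompactPencilsAtRelDim_anti` —
  `d ≤ d' → (5∀)_{d'} → (5∀)_d`; **`lefschetzBCompactPencils_iff_forall_le` — X ⟺ `∀ d ≥ d₀, (5∀)_d` FOR EVERY `d₀`**
  (the tree had `d₀ = 2` unconditionally and `d₀ = 3` modulo Tankeev; now every `d₀`, no fact), in particular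
  `lefschetzBCompactPencils_iff_forall_eight_le` — X is EXACTLY the tail `∀ d ≥ 8, (5∀)_d` consumed by the cell row
  `hodgeAbelianVarieties_of_HC_CM_of_abdulali_of_forall_ge_eight_lefschetzBCompactPencilsAtRelDim`.
* §3 the CM-pointed node: **`lefschetzBCMPointedPencilsAtRelDim_of_add` — `(5)_{r+d} ⟹ (5)_d`** (pad with a CM abelian
  `r`-fold), `lefschetzBCMPointedPencilsAtRelDim_anti`, `lefschetzBCMPointedPencils_iff_forall_le`.
* §4 consequences: the β-column inherits the tails through `(5)_d ⟹ (β′)_d`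
  (`fibreClassLefschetzOnAtRelDim_of_forall_le_lefschetzBCMPointedPencilsAtRelDim`); the cell row with ANY tail:
  `hodgeAbelianVarieties_of_HC_CM_of_forall_le_lefschetzBCMPointedPencilsAtRelDim` — `HC_CM ∧ [∀ d ≥ d₀, (5)_d] ⟹ HC_AV`
  modulo c11 for every `d₀` (Abdulali's (1.1) is the tree's theorem `abdulali1994_holds`).

HONEST COLUMN. No definition, no named fact, no sorry. Nothing is discharged: nesting runs DOWNWARD only (a high rung
implies the low ones), so Tankeev's rung and the rungs `d ≤ 1` are implied by, and give no purchase on, the open rungs;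
the UPWARD direction `(5∀)_d ⟹ (5∀)_{d+1}` is not claimed. References: Andre1996Motifs (§6.3 Remarque 2 p. 33, Lemme 6.3.1
p. 31), Arapura2006 (§1 Cor. 1.2, §4 Lemma 4.2), Kleiman1968AlgebraicCycles (Cor. 2.5), BrosnanFangNiePearlstein2009
(§6 Lemma 48: the padding `X ↦ B × X`), Abdulali1994FamiliesAV ((1.1)), Milne1999 (§2: CM products).
-/

noncomputable section

-- every declaration of this problem lives in `Summit.HodgeConjecture.HodgeConjecture.…` (summit = sub-problem)
set_option linter.dupNamespace false

open CategoryTheory CategoryTheory.Limits AlgebraicGeometry MonoidalCategory CartesianMonoidalCategory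
open Literature.AlgebraicGeometry Literature.AlgebraicGeometry.Motives Literature.AlgebraicGeometry.HodgeTheory
open Literature.AlgebraicGeometry.Milne1999 (IsOfCMType)
open Literature.AlgebraicGeometry.Deligne1982 (cmLocus)
open Literature.AlgebraicGeometry.Andre1996 (andre1996_cmAnchoredPencil)
open Summit.HodgeConjecture.HodgeConjecture.Ring2.AbelianAll

namespace Summit.HodgeConjecture.HodgeConjecture.Theorems

variable {d : ℕ} {𝒳 S : SchemeOver ℂ} {f : 𝒳 ⟶ S}

/-! ## §1 `B⋆` for the total space of a pencil from `B⋆` for the total space of a product pencil -/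

/-- The projection `B × 𝒳 ⟶ 𝒳` is surjective: it has the section `(0_B, 𝟙)`. [folklore] -/
theorem surjective_snd_left (B : AbelianVariety ℂ) (𝒳 : SchemeOver ℂ) : Surjective (snd B.X 𝒳).left := by
  have h' : (lift (toSpecOver 𝒳 ≫ (1 : B.Points ℂ)) (𝟙 𝒳)).left ≫ (snd B.X 𝒳).left = 𝟙 𝒳.left := by
    rw [← Over.comp_left, lift_snd]
    rfl
  refine ⟨fun x ↦ ⟨(lift (toSpecOver 𝒳 ≫ (1 : B.Points ℂ)) (𝟙 𝒳)).left.base x, ?_⟩⟩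
  change ((lift (toSpecOver 𝒳 ≫ (1 : B.Points ℂ)) (𝟙 𝒳)).left ≫ (snd B.X 𝒳).left).base x = x
  rw [h']
  rfl

/-- **`B⋆(𝒳, η)` for every `η` from `B⋆(B × 𝒳, θ)` for every `θ`**, for a compact pencil of abelian `d`-folds
`f : 𝒳 ⟶ S` and any complex abelian variety `B`: the product pencil `B × 𝒳 ⟶ S` is a compact pencil of abelian
`(dim B + d)`-folds (ab-andre-2 XXXII-a) whose total space surjects onto `𝒳`, and `B⋆` descends along surjections (gen 41).
The hypothesis is NOT asserted. [cite: Arapura2006, §1 Cor. 1.2 and §4 Lemma 4.2] [cite: BrosnanFangNiePearlstein2009, §6 Lemma 48] -/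
theorem lefschetzB_pencil_of_prod (hf : IsCompactAbelianPencil f d) (B : AbelianVariety ℂ)
    (hB : ∀ θ : complexBetti (B.X ⊗ 𝒳) 2, StandardConjectureBStar (B.dim + d + 1) (B.X ⊗ 𝒳) θ)
    (η : complexBetti 𝒳 2) : StandardConjectureBStar (d + 1) 𝒳 η :=
  haveI := surjective_snd_left B 𝒳
  standardConjectureBStar_of_surjective_of_forall (isCompactAbelianPencil_snd_comp hf B).isSmoothProjective_total
    hf.isSmoothProjective_total (snd B.X 𝒳) hB η

/-! ## §2 The rungs `(5∀)_d` are nested downward; X equals each of its tails -/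

/-- **`(5∀)_{r+d} ⟹ (5∀)_d`**: pad every compact pencil of abelian `d`-folds with an abelian `r`-fold `B` (which exists:
`exists_abelianVariety_dim_eq_succ`; `r = 0` is trivial) and descend along `B × 𝒳 ⟶ 𝒳`.
[cite: Andre1996Motifs, §6.3 Remarque 2 (p. 33)] [cite: Arapura2006, §4 Lemma 4.2] -/
theorem lefschetzBCompactPencilsAtRelDim_of_add (d r : ℕ) (h : LefschetzBCompactPencilsAtRelDim (r + d)) :
    LefschetzBCompactPencilsAtRelDim d := by
  intro 𝒳 S f hf η
  rcases r with _ | r'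
  · exact (Nat.zero_add d ▸ h) f hf η
  · obtain ⟨B, hB⟩ := exists_abelianVariety_dim_eq_succ ℂ r'
    refine lefschetzB_pencil_of_prod hf B (fun θ ↦ ?_) η
    have h' := h (snd B.X 𝒳 ≫ f) (hB ▸ isCompactAbelianPencil_snd_comp hf B) θ
    rwa [hB]

/-- **The rungs of X are nested downward: `d ≤ d' → (5∀)_{d'} → (5∀)_d`.** [cite: Andre1996Motifs, §6.3 Remarque 2 (p. 33)] -/
theorem lefschetzBCompactPencilsAtRelDim_anti {d d' : ℕ} (hdd' : d ≤ d') (h : LefschetzBCompactPencilsAtRelDim d') :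
    LefschetzBCompactPencilsAtRelDim d := by
  obtain ⟨r, rfl⟩ : ∃ r, d' = r + d := ⟨d' - d, by omega⟩
  exact lefschetzBCompactPencilsAtRelDim_of_add d r h

/-- **X = (5∀) IS EQUIVALENT TO EACH OF ITS TAILS: `LefschetzBCompactPencils ↔ ∀ d ≥ d₀, (5∀)_d`, for every `d₀`,
UNCONDITIONALLY** (the tree had `d₀ = 2` fact-free, `lefschetzBCompactPencils_iff_forall_two_le`, and `d₀ = 3` modulo
Tankeev 2011, `lefschetzBCompactPencils_iff_forall_three_le_of_tankeev2011`). [cite: Andre1996Motifs, §6.3 Remarque 2 (p. 33)] -/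
theorem lefschetzBCompactPencils_iff_forall_le (d₀ : ℕ) :
    LefschetzBCompactPencils ↔ ∀ d : ℕ, d₀ ≤ d → LefschetzBCompactPencilsAtRelDim d := by
  refine lefschetzBCompactPencils_iff_forall_atRelDim.trans ⟨fun h d _ ↦ h d, fun h d ↦ ?_⟩
  rcases Nat.lt_or_ge d d₀ with hd | hd
  · exact lefschetzBCompactPencilsAtRelDim_anti hd.le (h d₀ le_rfl)
  · exact h d hd

/-- **In particular X is EXACTLY the tail `∀ d ≥ 8, (5∀)_d`** — the hypothesis shape of the cell row
`hodgeAbelianVarieties_of_HC_CM_of_abdulali_of_forall_ge_eight_lefschetzBCompactPencilsAtRelDim` (pencils through `g`-folds,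
`g ≥ 4`, have relative dimension `2g ≥ 8`). [cite: Andre1996Motifs, Lemme 6.3.1 (p. 31) and Remarque 2 (p. 33)] -/
theorem lefschetzBCompactPencils_iff_forall_eight_le :
    LefschetzBCompactPencils ↔ ∀ d : ℕ, 8 ≤ d → LefschetzBCompactPencilsAtRelDim d :=
  lefschetzBCompactPencils_iff_forall_le 8

/-- **A single rung carries all lower ones**: `(5∀)_{d'} ⟹ ∀ d ≤ d', (5∀)_d`; e.g. the cell-relevant rung `d' = 8`
implies Tankeev's rung `d = 2` and everything below — the low rungs are not on the critical path.
[cite: Andre1996Motifs, §6.3 Remarque 2 (p. 33)] -/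
theorem forall_le_lefschetzBCompactPencilsAtRelDim_of (d' : ℕ) (h : LefschetzBCompactPencilsAtRelDim d') :
    ∀ d : ℕ, d ≤ d' → LefschetzBCompactPencilsAtRelDim d :=
  fun _ hd ↦ lefschetzBCompactPencilsAtRelDim_anti hd h

/-! ## §3 The CM-pointed rungs `(5)_d` are nested downward too -/

/-- **`(5)_{r+d} ⟹ (5)_d`**: pad with a CM abelian `r`-fold (`exists_isOfCMType_dim_eq_succ`), which keeps the pencil
CM-pointed (`cmLocus_subset_cmLocus_snd_comp`). [cite: Andre1996Motifs, Lemme 6.3.1 (ii) (p. 31) and Remarque 2 (p. 33)]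
[cite: Milne1999, §2 (p. 54)] -/
theorem lefschetzBCMPointedPencilsAtRelDim_of_add (d r : ℕ) (h : LefschetzBCMPointedPencilsAtRelDim (r + d)) :
    LefschetzBCMPointedPencilsAtRelDim d := by
  intro 𝒳 S f hf hcm η
  rcases r with _ | r'
  · exact (Nat.zero_add d ▸ h) f hf hcm η
  · obtain ⟨B, hB, hBcm⟩ := exists_isOfCMType_dim_eq_succ r'
    have hcm' : (cmLocus (snd B.X 𝒳 ≫ f) (B.dim + d)).Nonempty :=
      hcm.mono (cmLocus_subset_cmLocus_snd_comp f B hBcm)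
    haveI := surjective_snd_left B 𝒳
    refine standardConjectureBStar_of_surjective_of_forall (isCompactAbelianPencil_snd_comp hf B).isSmoothProjective_total
      hf.isSmoothProjective_total (snd B.X 𝒳) (fun θ ↦ ?_) η
    have h' := h (snd B.X 𝒳 ≫ f) (hB ▸ isCompactAbelianPencil_snd_comp hf B) (hB ▸ hcm') θ
    rwa [hB]

/-- **`d ≤ d' → (5)_{d'} → (5)_d`.** [cite: Andre1996Motifs, §6.3 Remarque 2 (p. 33)] -/
theorem lefschetzBCMPointedPencilsAtRelDim_anti {d d' : ℕ} (hdd' : d ≤ d') (h : LefschetzBCMPointedPencilsAtRelDim d') :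
    LefschetzBCMPointedPencilsAtRelDim d := by
  obtain ⟨r, rfl⟩ : ∃ r, d' = r + d := ⟨d' - d, by omega⟩
  exact lefschetzBCMPointedPencilsAtRelDim_of_add d r h

/-- **(5) = `LefschetzBCMPointedPencils` is equivalent to each of its tails `∀ d ≥ d₀, (5)_d`, unconditionally.**
[cite: Andre1996Motifs, §6.3 Remarque 2 (p. 33)] -/
theorem lefschetzBCMPointedPencils_iff_forall_le (d₀ : ℕ) :
    LefschetzBCMPointedPencils ↔ ∀ d : ℕ, d₀ ≤ d → LefschetzBCMPointedPencilsAtRelDim d := by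
  refine lefschetzBCMPointedPencils_iff_forall_atRelDim.trans ⟨fun h d _ ↦ h d, fun h d ↦ ?_⟩
  rcases Nat.lt_or_ge d d₀ with hd | hd
  · exact lefschetzBCMPointedPencilsAtRelDim_anti hd.le (h d₀ le_rfl)
  · exact h d hd

/-! ## §4 Consequences: the β-column tails and the cell row with an arbitrary tail -/

/-- **The β-column inherits every tail of (5)**: `[∀ d ≥ d₀, (5)_d] ⟹ ∀ d, (β′)_d` (nesting, then the tree's
unconditional `(5)_d ⟹ (β′)_d`, gen 42 `LefschetzBCMPointedPencilsAtRelDim.fibreClassLefschetzOnAtRelDim`).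
[cite: Abdulali1994FamiliesAV, Conjecture 5.3 (p. 1130)] [cite: Andre1996Motifs, Thm. 0.4 (p. 8)] -/
theorem fibreClassLefschetzOnAtRelDim_of_forall_le_lefschetzBCMPointedPencilsAtRelDim (d₀ : ℕ)
    (h : ∀ d : ℕ, d₀ ≤ d → LefschetzBCMPointedPencilsAtRelDim d) (d : ℕ) : FibreClassLefschetzOnAtRelDim d :=
  LefschetzBCMPointedPencilsAtRelDim.fibreClassLefschetzOnAtRelDim
    (lefschetzBCMPointedPencils_iff_forall_atRelDim.1 ((lefschetzBCMPointedPencils_iff_forall_le d₀).2 h) d)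

/-- **The cell row with an ARBITRARY tail: `HC_CM ∧ [∀ d ≥ d₀, (5)_d] ⟹ HC_AV` modulo Lemme 6.3.1 (c11), for every `d₀`**
(`HC_CM` BY NAME, load-bearing; Abdulali's (1.1) is the tree's theorem `abdulali1994_holds`; the rungs below `d₀` come
for free by nesting). research route conditional on HC_CM; not a corollary; Q11.4-sentence-2 already refuted in dim ≥ 3.
[cite: Andre1996Motifs, Lemme 6.3.1 (p. 31) and Remarque 2 (p. 33)] [cite: Abdulali1994FamiliesAV, (1.1) (p. 1122)] -/
theorem hodgeAbelianVarieties_of_HC_CM_of_forall_le_lefschetzBCMPointedPencilsAtRelDim (d₀ : ℕ)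
    (h₂₁ : andre1996_cmAnchoredPencil) (hCM : Theses.RankFourFaces.CMAbelianHodge)
    (hB : ∀ d : ℕ, d₀ ≤ d → LefschetzBCMPointedPencilsAtRelDim d) :
    Theses.PadicSemiregularLift.HodgeAbelianVarieties :=
  hodgeAbelianVarieties_of_HC_CM_of_abdulali_of_forall_ge_four_lefschetzBCMPointedPencilsAtRelDim abdulali1994_holds
    h₂₁ hCM fun g _ ↦ lefschetzBCMPointedPencils_iff_forall_atRelDim.1 ((lefschetzBCMPointedPencils_iff_forall_le d₀).2 hB) (2 * g)

end Summit.HodgeConjecture.HodgeConjecture.Theorems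

end
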